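import Summits.BirchSwinnertonDyer.BirchSwinnertonDyer.Theorems.ByReductionTypeAtTwoTorsionEulerCharH46OfT1
import Literature.NumberTheory.EllipticCurves.RationalTorsionKernelOfReduction
import HarnessLib

set_option linter.dupNamespace false -- `…BirchSwinnertonDyer.BirchSwinnertonDyer…` is the cell's nested layout (D-0017)
set_option autoImplicit false

/-!
# H46 kernel programme (road C′): the ODD primes — `H46` unconditionally, and Greenberg's Theorem 4.1 display
# `greenberg_charValue_rankZero` AS A THEOREM

Cell `bsd-2adic` (run/shared/lean/pub/bsd-2adic/), seat `bsd-2adic-tower-1` GEN 35; `--supports stmt-BirchSwinnertonDyer-19271`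
(helper, item `OrdKatoHalfAtTwo`, TOWER road). THEOREMS ONLY (no definition, no named fact, no instance, no `sorry`); closes no item;
nothing booked; BSD is not proved by any of this.

For an odd prime `p` the side condition (T₁) «`E(ℚ)[p^∞] ∩ E₁(ℚ̄_p) = 0`» of `…H46OfT1` is a theorem
(`RationalTorsionKernelOfReduction.t1_of_odd`: the formal group of the minimal model has no `ℚ_p`-rational `p`-torsion,
Silverman IV.6.1 / VII.3.1). Hence, for every `E/ℚ` with good ORDINARY reduction at an odd prime `p`, `κ` cyclotomic and
`Sel_{p^∞}(E/ℚ)` finite: **`H46(W, p, κ, v₀)` at every good `v₀ ∉ S`** (`lemma46At_odd`, `exists_lemma46_odd`), and **the named fact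
`greenberg_charValue_rankZero` (Greenberg's Thm. 4.1 display in `ℚ_p`, rank `0`, every odd good ordinary `p`, ANY rational
`p`-torsion) HOLDS** (`greenberg_charValue_rankZero_holds`) — previously available in the tree only from the print input
`Greenberg1999.lemma46_gammaInvariants_auxPlace_rat` (`…TorsionEulerCharFact`) or from `Schneider1985_order_charGenerator_odd` +
`mazur_tate_sigma_exists_odd` (`Greenberg1999/RankZeroEulerCharacteristicOddPrimeProofs`).
[cite: GreenbergLNM1716, Thm. 4.1 (p. 102), §4 Lemmas 4.6–4.7 (pp. 105–108)] [cite: SilvermanAEC2009, Prop. VII.3.1, Thm. IV.6.1]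
-/

noncomputable section

open scoped Classical NumberField

namespace Summit.BirchSwinnertonDyer.BirchSwinnertonDyer.Theorems

namespace TorsionEulerChar.H46LevelZero

open CategoryTheory Field NumberField IsDedekindDomain WeierstrassCurve
  Literature.NumberTheory.EllipticCurves Literature.NumberTheory.EllipticCurves.CyclotomicLayer
  Literature.NumberTheory.EllipticCurves.GreenbergSelmer
  Literature.NumberTheory.GaloisRepresentations Literature.NumberTheory.GaloisRepresentations.DiscreteGaloisModule
  Literature.NumberTheory.GaloisCohomology ZpExtension

/-- A place of `ℚ` above the rational prime `p` exists (private plumbing; cf. the `K`-general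
`GlobalFrobenioidModelsRmk362iGenuine.exists_heightOneSpectrum_natCast_mem`). [folklore] -/
private theorem exists_heightOneSpectrum_natCast_mem_rat (p : ℕ) [hp : Fact p.Prime] :
    ∃ vp : HeightOneSpectrum (𝓞 ℚ), ((p : ℕ) : 𝓞 ℚ) ∈ vp.asIdeal := by
  have hne : Ideal.span {((p : ℕ) : 𝓞 ℚ)} ≠ ⊤ := by
    rw [Ne, Ideal.span_singleton_eq_top]
    intro hu
    have h := hu.map (Rat.IsIntegralClosure.intEquiv (𝓞 ℚ))
    rw [map_natCast, Int.isUnit_iff_natAbs_eq, Int.natAbs_natCast] at h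
    exact hp.out.one_lt.ne' h
  obtain ⟨𝔪, h𝔪, hle⟩ := Ideal.exists_le_maximal _ hne
  have h𝔪0 : 𝔪 ≠ ⊥ := by
    intro h0
    rw [h0, le_bot_iff, Ideal.span_singleton_eq_bot] at hle
    exact (Nat.cast_ne_zero.2 hp.out.ne_zero) hle
  exact ⟨⟨𝔪, h𝔪.isPrime, h𝔪0⟩, hle (Ideal.mem_span_singleton_self _)⟩

/-- **`H46(W, p, κ, v₀)` for ODD good ordinary `p`, unconditionally** (`lemma46At_of_T1` with (T₁) discharged by
`RationalTorsionKernelOfReduction.t1_of_odd`): every `p`-power-torsion class `z ∈ H¹(Γ_{ℚ_{v₀}}, E(ℚ̄_{v₀}))` at a good place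
`v₀ ∉ S` is realised by a class `T ∈ H¹(ℚ_∞, E[p^∞])` all of whose conjugates are Kummer at every finite `v ≠ v₀` and at `∞`.
[cite: GreenbergLNM1716, §4 Lemma 4.6 (p. 105)] [cite: SilvermanAEC2009, Prop. VII.3.1, Thm. IV.6.1] -/
theorem lemma46At_odd (W : WeierstrassCurve ℚ) [W.IsElliptic] [W.IsGloballyMinimal] (p : ℕ) [hp : Fact p.Prime]
    (hp3 : 3 ≤ p) (κ : ZpExtension ℚ p) (hκ : κ.IsCyclotomic) (hord : IsOrdinaryAt W p)
    (S : Finset (HeightOneSpectrum (𝓞 ℚ)))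
    (hS : ∀ v : HeightOneSpectrum (𝓞 ℚ), v ∉ S → ((p : ℕ) : 𝓞 ℚ) ∉ v.asIdeal ∧ W.HasGoodReductionAt v)
    (v₀ : HeightOneSpectrum (𝓞 ℚ)) (hv₀ : v₀ ∉ S) [Finite (W.selmerGroupPInfty p)]
    (z : discreteH1 (localSubgroup (⊤ : Subgroup (absoluteGaloisGroup ℚ)) (v₀.adicCompletion ℚ))
      (localPoints W (v₀.adicCompletion ℚ))) (hz : ∃ k : ℕ, p ^ k • z = 0) :
    ∃ T : W.subgroupH1 p κ.kerSubgroup,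
      (∀ v : HeightOneSpectrum (𝓞 ℚ), v ≠ v₀ → ∀ σ : absoluteGaloisGroup ℚ,
        W.conjH1 p κ.kerSubgroup σ T ∈ W.localKerOver p κ.kerSubgroup (v.adicCompletion ℚ)) ∧
      (∀ (w : InfinitePlace ℚ) (σ : absoluteGaloisGroup ℚ),
        W.conjH1 p κ.kerSubgroup σ T ∈ W.localKerOver p κ.kerSubgroup w.Completion) ∧
      ∀ σ : absoluteGaloisGroup ℚ,
        W.localResOver p κ.kerSubgroup (v₀.adicCompletion ℚ) (W.conjH1 p κ.kerSubgroup σ T) =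
          Literature.NumberTheory.EllipticCurves.resOfLe (localPoints W (v₀.adicCompletion ℚ))
            (Subgroup.comap_mono le_top :
              localSubgroup κ.kerSubgroup (v₀.adicCompletion ℚ) ≤
                localSubgroup (⊤ : Subgroup (absoluteGaloisGroup ℚ)) (v₀.adicCompletion ℚ)) z := by
  obtain ⟨vp, hvp⟩ := exists_heightOneSpectrum_natCast_mem_rat p
  exact lemma46At_of_T1 W p κ hκ hord S hS v₀ hv₀ vp hvp (RationalTorsionKernelOfReduction.t1_of_odd W hp3 vp hvp) z hz

/-- **`∃` a good place `v₀ ∤ p` with `H46(W, p, κ, v₀)`, every ODD good ordinary `p`, unconditionally** — the hypothesis `h46` of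
`charValue_rankZero_of_lemma46` / `constantCoeff_mul_sq_eq_printed_of_lemma46`. [cite: GreenbergLNM1716, §4 Lemma 4.6 (p. 105)] -/
theorem exists_lemma46_odd (W : WeierstrassCurve ℚ) [W.IsElliptic] [W.IsGloballyMinimal] (p : ℕ) [hp : Fact p.Prime]
    (hp3 : 3 ≤ p) (hord : IsOrdinaryAt W p) (κ : ZpExtension ℚ p) (hκ : κ.IsCyclotomic) [Finite (W.selmerGroupPInfty p)] :
    ∃ v₀ : HeightOneSpectrum (𝓞 ℚ), ((p : ℕ) : 𝓞 ℚ) ∉ v₀.asIdeal ∧ W.HasGoodReductionAt v₀ ∧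
      ∀ z : discreteH1 (localSubgroup (⊤ : Subgroup (absoluteGaloisGroup ℚ)) (v₀.adicCompletion ℚ))
        (localPoints W (v₀.adicCompletion ℚ)), (∃ k : ℕ, p ^ k • z = 0) →
      ∃ T : W.subgroupH1 p κ.kerSubgroup,
        (∀ v : HeightOneSpectrum (𝓞 ℚ), v ≠ v₀ → ∀ σ : absoluteGaloisGroup ℚ,
          W.conjH1 p κ.kerSubgroup σ T ∈ W.localKerOver p κ.kerSubgroup (v.adicCompletion ℚ)) ∧
        (∀ (w : InfinitePlace ℚ) (σ : absoluteGaloisGroup ℚ),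
          W.conjH1 p κ.kerSubgroup σ T ∈ W.localKerOver p κ.kerSubgroup w.Completion) ∧
        ∀ σ : absoluteGaloisGroup ℚ,
          W.localResOver p κ.kerSubgroup (v₀.adicCompletion ℚ) (W.conjH1 p κ.kerSubgroup σ T) =
            Literature.NumberTheory.EllipticCurves.resOfLe (localPoints W (v₀.adicCompletion ℚ))
              (Subgroup.comap_mono le_top :
                localSubgroup κ.kerSubgroup (v₀.adicCompletion ℚ) ≤
                  localSubgroup (⊤ : Subgroup (absoluteGaloisGroup ℚ)) (v₀.adicCompletion ℚ)) z := by
  obtain ⟨vp, hvp⟩ := exists_heightOneSpectrum_natCast_mem_rat p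
  exact exists_lemma46_of_T1 W p hord κ hκ vp hvp (RationalTorsionKernelOfReduction.t1_of_odd W hp3 vp hvp)

/-- **Greenberg's Theorem 4.1 display in `ℚ_p` at an ODD good ordinary prime, ANY rational `p`-torsion, UNCONDITIONALLY**:
`fE(0) · #E(ℚ)(p)² = u · p^{ord_p ∏ c_ℓ} · #Ẽ(𝔽_p)(p)² · #Sel_{p^∞}(E/ℚ)`, `u ∈ ℤ_pˣ`.
[cite: GreenbergLNM1716, Thm. 4.1 (p. 102), §4 Lemmas 4.6–4.7 (pp. 105–108)] -/
theorem charValue_rankZero_odd (p : ℕ) [hp : Fact p.Prime] (hp3 : 3 ≤ p) (W : WeierstrassCurve ℚ)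
    [W.IsGloballyMinimal] [W.IsElliptic] (hgo : Rank1Residual.GoodOrd W p) (κ : ZpExtension ℚ p) (hκ : κ.IsCyclotomic)
    {γ : absoluteGaloisGroup ℚ} (hγ : κ.IsTopGenerator γ) (D : W.SelmerDualData κ γ) [Finite (W.selmerGroupPInfty p)]
    (fE : IwasawaAlgebra p) (hf : D.charIdeal = Ideal.span {fE}) :
    ∃ u : ℤ_[p]ˣ,
      ((PowerSeries.constantCoeff fE : ℤ_[p]) : ℚ_[p]) *
          (Nat.card (AddCommGroup.primaryComponent W.toAffine.Point p) : ℚ_[p]) ^ 2 =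
        ((u : ℤ_[p]) : ℚ_[p]) * (p : ℚ_[p]) ^ (padicValNat p W.tamagawaProduct) *
          (Nat.card (AddCommGroup.primaryComponent
            ((integralModelInt W).map (Int.castRingHom (ZMod p))).toAffine.Point p) : ℚ_[p]) ^ 2 *
          (Nat.card (W.selmerGroupPInfty p) : ℚ_[p]) := by
  obtain ⟨vp, hvp⟩ := exists_heightOneSpectrum_natCast_mem_rat p
  exact charValue_rankZero_of_T1 p W hgo κ hκ hγ D vp hvp (RationalTorsionKernelOfReduction.t1_of_odd W hp3 vp hvp) fE hf

/-- **The named fact `greenberg_charValue_rankZero` HOLDS** (Greenberg's Theorem 4.1 over `ℚ`, rank `0`, every ODD good ordinary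
`p`, any rational `p`-torsion — `Literature/NumberTheory/EllipticCurves/IwasawaLeadingTerm`): a consumer's binder
`(hGr : greenberg_charValue_rankZero)` is discharged by this theorem. Assembled from the kernel `H46` programme of this cell
(`lemma46At_of_T1`, GEN 34–35) and Silverman VII.3.1 (`RationalTorsionKernelOfReduction.t1_of_odd`).
[cite: GreenbergLNM1716, Thm. 4.1 (p. 102), §4 Lemmas 4.6–4.7 (pp. 105–108)] [cite: SilvermanAEC2009, Prop. VII.3.1, Thm. IV.6.1] -/
theorem greenberg_charValue_rankZero_holds : greenberg_charValue_rankZero := by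
  intro W _ _ p _ hp2 hgood hord κ γ hκ hγ _ D _ _ fE hf hSel
  haveI := hSel
  have hp3 : 3 ≤ p := by
    have h2 := (Fact.out : p.Prime).two_le
    omega
  exact charValue_rankZero_odd p hp3 W ⟨hgood, hord⟩ κ hκ hγ D fE hf

end TorsionEulerChar.H46LevelZero

end Summit.BirchSwinnertonDyer.BirchSwinnertonDyer.Theorems
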